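import Summits.MatrixMultiplication.MatrixMultiplication.Theorems.OutsiderSandwichNoTightExchange
import HarnessLib

/-!
# Slice calculus for the exchange table: linearity, block slices, conciseness in slice form

Route `OutsiderSandwich` (decomposition cell `decomp-mm`, lens 4 «minimal counterexample /
extremal reduction», gen 28, addendum), support for the aside leaf `BlockOneIsMM`
(stmt-MatrixMultiplication-27147); toolkit for `OutsiderSandwichNoCatalysis`.

The input-leg slices `S_w = ∑_b w(b)·u(·, b, ·)` of `OutsiderSandwichNoTightExchange` are linear
in the weight and block diagonal on direct sums (`slice_directSum`).  For the two sides of the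
exchange table — `tgt N m = ⟨m⟩ ⊠ ⟨2,2,2⟩^{⊠N}` and the pair-tensor form
`src N m = ⟨m⟩ ⊠ P^{⊠N}` of `⟨m⟩ ⊠ C₁^{⊠N}` — and for the padded target
`tgt N m ⊕ src N k` we prove CONCISENESS IN SLICE FORM on both vector legs: an input weight with
zero slice is zero (`*_weight_eq_zero`), and a vector killed by every input slice is zero
(`*_vec_eq_zero`); the witnesses are explicit index triples meeting in exactly one point
(`tgt_point`, `src_point`).  Finally, a matrix between index types of equal size with injective
`mulVec` has a two-sided inverse (`exists_two_sided_inv`) — this is how conciseness turns the leg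
maps of an equal-format restriction into invertible matrices.

## References
* P. Bürgisser, M. Clausen, M. A. Shokrollahi, *Algebraic Complexity Theory*, Springer (1997),
  §14.4 (restriction, slices, concise tensors). [BurgisserClausenShokrollahi1997]
* D. Coppersmith, S. Winograd, *Matrix multiplication via arithmetic progressions*,
  J. Symbolic Comput. 9 (1990) 251–280, §7 (the coupled block). [CoppersmithWinograd1990]
* M. Christandl, P. Vrana, J. Zuiddam, *Universal points in the asymptotic spectrum of tensors*,
  J. Amer. Math. Soc. 36 (2023), §1.1 (direct sums). [ChristandlVranaZuiddam2023]
-/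

noncomputable section

open scoped BigOperators Matrix

set_option linter.dupNamespace false
set_option autoImplicit false

namespace Summit.MatrixMultiplication.MatrixMultiplication.Theorems.OutsiderSandwichSliceConcise

open Literature.Computability.AlgebraicComplexity
open Summit.MatrixMultiplication.MatrixMultiplication.Theorems.OutsiderSandwichBlockNormalForm
  (pairTensor)
open Summit.MatrixMultiplication.MatrixMultiplication.Theorems.OutsiderSandwichNoTightExchange

/-! ## 1. Linear algebra: slices are linear, block slices, injective square maps invert -/

section LinAlg

variable {L : Type} [Field L]
variable {ι κ μ ι' κ' μ' : Type} [Fintype κ] [Fintype κ']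

/-- Slices are additive in the weight. [cite: BurgisserClausenShokrollahi1997, §14.4] -/
theorem slice_add (u : ι → κ → μ → L) (w w' : κ → L) :
    slice u (w + w') = slice u w + slice u w' := by
  ext a c; simp only [slice_apply, Pi.add_apply, Matrix.add_apply, add_mul, Finset.sum_add_distrib]

/-- Slices are odd in the weight. [cite: BurgisserClausenShokrollahi1997, §14.4] -/
theorem slice_neg (u : ι → κ → μ → L) (w : κ → L) : slice u (-w) = -slice u w := by
  ext a c; simp only [slice_apply, Pi.neg_apply, Matrix.neg_apply, neg_mul, Finset.sum_neg_distrib]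

/-- The slice at the zero weight vanishes. [cite: BurgisserClausenShokrollahi1997, §14.4] -/
theorem slice_zero (u : ι → κ → μ → L) : slice u (0 : κ → L) = 0 := by
  ext a c
  simp only [slice_apply, Pi.zero_apply, zero_mul, Finset.sum_const_zero, Matrix.zero_apply]

/-- The slice at a coordinate weight is the coordinate slice.
[cite: BurgisserClausenShokrollahi1997, §14.4] -/
theorem slice_single [DecidableEq κ] (u : ι → κ → μ → L) (b₀ : κ) :
    slice u (fun b => if b = b₀ then 1 else 0) = Matrix.of fun a c => u a b₀ c := by
  ext a c; simp [slice_apply, Finset.sum_ite_eq']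

/-- **Slices of a direct sum are block diagonal.** [cite: ChristandlVranaZuiddam2023, §1.1] -/
theorem slice_directSum (s : ι → κ → μ → L) (t : ι' → κ' → μ' → L) (w : κ ⊕ κ' → L) :
    slice (directSumTensor s t) w =
      Matrix.fromBlocks (slice s fun b => w (Sum.inl b)) 0 0 (slice t fun b => w (Sum.inr b)) := by
  ext a c
  rcases a with a | a <;> rcases c with c | c <;>
    simp [slice_apply, Fintype.sum_sum_type, directSumTensor]

/-- A matrix between index types of the same size whose `mulVec` is injective has a two-sided
inverse. [cite: BurgisserClausenShokrollahi1997, §14.4] -/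
theorem exists_two_sided_inv {α β : Type} [Fintype α] [Fintype β] [DecidableEq α] [DecidableEq β]
    (M : Matrix α β L) (hcard : Fintype.card β = Fintype.card α)
    (hinj : ∀ v, M.mulVec v = 0 → v = 0) : ∃ D : Matrix β α L, M * D = 1 ∧ D * M = 1 := by
  let e : α ≃ β := Fintype.equivOfCardEq hcard.symm
  obtain ⟨M', rfl⟩ : ∃ M' : Matrix α α L, M = M'.submatrix id e.symm :=
    ⟨M.submatrix id e, by ext i b; simp⟩
  have hinj' : Function.Injective M'.mulVec := by
    intro v v' hvv'
    have h0 : M'.mulVec (v - v') = 0 := by rw [Matrix.mulVec_sub, hvv', sub_self]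
    have h1 : (M'.submatrix id e.symm).mulVec ((v - v') ∘ e.symm) = 0 := by
      rw [Matrix.submatrix_mulVec_equiv]
      simp only [Equiv.symm_symm, Function.comp_assoc, Equiv.symm_comp_self, Function.comp_id]
      exact h0
    have h3 := hinj _ h1
    exact sub_eq_zero.mp (funext fun j => by simpa using congrFun h3 (e j))
  have hdet : IsUnit M'.det :=
    (Matrix.isUnit_iff_isUnit_det M').mp (Matrix.mulVec_injective_iff_isUnit.mp hinj')
  refine ⟨M'⁻¹.submatrix e.symm id, ?_, ?_⟩
  · rw [← Matrix.submatrix_mul M' M'⁻¹ id (⇑e.symm) id e.symm.bijective,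
      Matrix.mul_nonsing_inv _ hdet, Matrix.submatrix_id_id]
  · rw [← Matrix.submatrix_mul M'⁻¹ M' (⇑e.symm) id (⇑e.symm) Function.bijective_id,
      Matrix.nonsing_inv_mul _ hdet, Matrix.submatrix_one_equiv]

/-- `Sum.elim` is additive. [folklore] -/
theorem sum_elim_add {α β : Type} (a a' : α → L) (b b' : β → L) :
    Sum.elim (a + a') (b + b') = Sum.elim a b + Sum.elim a' b' := by
  funext x; cases x <;> rfl

/-- `Sum.elim` is odd. [folklore] -/
theorem sum_elim_neg {α β : Type} (a : α → L) (b : β → L) :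
    Sum.elim (-a) (-b) = -Sum.elim a b := by
  funext x; cases x <;> rfl

end LinAlg

/-! ## 2. Conciseness of the two summands in slice form -/

section Concise

variable (N m : ℕ)

/-- Point evaluation of `⟨m⟩ ⊠ ⟨2,2,2⟩^{⊠N}`: the output index with letters `((g j).1, 0)` and the
`Y`-index with letters `((g j).2, 0)` meet exactly the `X`-index `(i, g)`.
[cite: BurgisserClausenShokrollahi1997, §14.4] -/
theorem tgt_point (i : Fin m) (g : Fin N → Fin 2 × Fin 2) (b : J N m) :
    tgt N m (i, fun j => ((g j).1, 0)) b (i, fun j => ((g j).2, 0)) =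
      if b = (i, g) then 1 else 0 := by
  have matMulTensor_apply' : ∀ (a b c : Fin 2 × Fin 2), matMulTensor ℂ 2 2 2 a b c =
      if a.1 = b.1 ∧ b.2 = c.1 ∧ a.2 = c.2 then 1 else 0 := fun _ _ _ => rfl
  dsimp only [tgt]
  by_cases hb : b = (i, g)
  · subst hb
    rw [if_pos rfl, kroneckerTensor_apply, kroneckerPow_apply, unitTensor_apply,
      if_pos ⟨rfl, rfl⟩, one_mul]
    refine Finset.prod_eq_one fun j _ => ?_
    rw [matMulTensor_apply', if_pos ⟨rfl, rfl, rfl⟩]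
  · rw [if_neg hb, kroneckerTensor_apply]
    by_cases h1 : b.1 = i
    · have h2 : b.2 ≠ g := fun h2 => hb (Prod.ext h1 h2)
      obtain ⟨j, hj⟩ := Function.ne_iff.mp h2
      rw [kroneckerPow_apply, Finset.prod_eq_zero (Finset.mem_univ j), mul_zero]
      rw [matMulTensor_apply', if_neg]
      rintro ⟨e1, e2, -⟩
      exact hj (Prod.ext e1.symm e2)
    · rw [unitTensor_apply, if_neg (fun h => h1 h.1.symm), zero_mul]

/-- `⟨m⟩ ⊠ ⟨2,2,2⟩^{⊠N}` is concise on the input leg, in slice form: a weight with zero slice is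
zero. [cite: BurgisserClausenShokrollahi1997, §14.4] -/
theorem tgt_weight_eq_zero {w : J N m → ℂ} (h : slice (tgt N m) w = 0) : w = 0 := by
  funext x
  obtain ⟨i, g⟩ := x
  have h1 := congrFun (congrFun h (i, fun j => ((g j).1, 0))) (i, fun j => ((g j).2, 0))
  rw [slice_apply, Matrix.zero_apply] at h1
  simp only [tgt_point, mul_ite, mul_one, mul_zero, Finset.sum_ite_eq', Finset.mem_univ,
    if_true] at h1
  exact h1

/-- `⟨m⟩ ⊠ ⟨2,2,2⟩^{⊠N}` is concise on the output leg, in slice form: a vector killed by every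
input slice is zero (the identity-pattern slice is `1`).
[cite: BurgisserClausenShokrollahi1997, §14.4] -/
theorem tgt_vec_eq_zero {ζ : J N m → ℂ} (h : ∀ w, (slice (tgt N m) w).mulVec ζ = 0) : ζ = 0 := by
  simpa [slice_tgt_idWeight] using h (idWeight N m)

/-- The matrix letter meeting the input letter `y` (pair-tensor form).
[cite: CoppersmithWinograd1990, §7] -/
def inLetter (y : Fin 2 × Fin 2) : Fin 2 × Fin 2 := if y.1 = 0 then (0, y.2) else (y.2, 0)

/-- The output letter meeting the input letter `y` (pair-tensor form).
[cite: CoppersmithWinograd1990, §7] -/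
def outLetter (y : Fin 2 × Fin 2) : Fin 2 × Fin 2 := if y.1 = 0 then (1, 0) else (0, 0)

/-- Point evaluation of the pair tensor: `(inLetter y, ·, outLetter y)` meets exactly `y`.
[cite: CoppersmithWinograd1990, §7] -/
theorem pair_point (y b : Fin 2 × Fin 2) :
    pairTensor 2 (inLetter y) b (outLetter y) = if b = y then 1 else 0 := by
  obtain ⟨y1, y2⟩ := y
  obtain ⟨b1, b2⟩ := b
  fin_cases y1 <;> fin_cases y2 <;> fin_cases b1 <;> fin_cases b2 <;>
    simp +decide [pairTensor]

/-- Point evaluation of `⟨m⟩ ⊠ P^{⊠N}`. [cite: CoppersmithWinograd1990, §7] -/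
theorem src_point (i : Fin m) (g : Fin N → Fin 2 × Fin 2) (b : J N m) :
    src N m (i, fun j => inLetter (g j)) b (i, fun j => outLetter (g j)) =
      if b = (i, g) then 1 else 0 := by
  dsimp only [src]
  by_cases hb : b = (i, g)
  · subst hb
    rw [if_pos rfl, kroneckerTensor_apply, kroneckerPow_apply, unitTensor_apply,
      if_pos ⟨rfl, rfl⟩, one_mul]
    refine Finset.prod_eq_one fun j _ => ?_
    dsimp only
    rw [pair_point, if_pos rfl]
  · rw [if_neg hb, kroneckerTensor_apply]
    by_cases h1 : b.1 = i
    · have h2 : b.2 ≠ g := fun h2 => hb (Prod.ext h1 h2)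
      obtain ⟨j, hj⟩ := Function.ne_iff.mp h2
      rw [kroneckerPow_apply, Finset.prod_eq_zero (Finset.mem_univ j), mul_zero]
      dsimp only
      rw [pair_point, if_neg hj]
    · rw [unitTensor_apply, if_neg (fun h => h1 h.1.symm), zero_mul]

/-- `⟨m⟩ ⊠ P^{⊠N}` is concise on the input leg, in slice form.
[cite: CoppersmithWinograd1990, §7] -/
theorem src_weight_eq_zero {w : J N m → ℂ} (h : slice (src N m) w = 0) : w = 0 := by
  funext x
  obtain ⟨i, g⟩ := x
  have h1 := congrFun (congrFun h (i, fun j => inLetter (g j))) (i, fun j => outLetter (g j))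
  rw [slice_apply, Matrix.zero_apply] at h1
  simp only [src_point, mul_ite, mul_one, mul_zero, Finset.sum_ite_eq', Finset.mem_univ,
    if_true] at h1
  exact h1

/-- `⟨m⟩ ⊠ P^{⊠N}` is concise on the output leg, in slice form (by the input/output symmetry of
`P`). [cite: CoppersmithWinograd1990, §7] -/
theorem src_vec_eq_zero {ζ : J N m → ℂ} (h : ∀ w, (slice (src N m) w).mulVec ζ = 0) : ζ = 0 := by
  classical
  funext x
  obtain ⟨i, g⟩ := x
  have h1 := congrFun (h fun b => if b = (i, fun j => outLetter (g j)) then 1 else 0)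
    (i, fun j => inLetter (g j))
  rw [slice_single] at h1
  simp only [Matrix.mulVec, dotProduct, Matrix.of_apply, Pi.zero_apply] at h1
  have h2 : ∀ c : J N m, src N m (i, fun j => inLetter (g j)) (i, fun j => outLetter (g j)) c =
      if c = (i, g) then 1 else 0 := fun c => by rw [src_symm N m, src_point]
  simp only [h2, ite_mul, one_mul, zero_mul, Finset.sum_ite_eq', Finset.mem_univ,
    if_true] at h1
  exact h1

end Concise

/-! ## 3. No catalysis -/

section Main

variable {N m k : ℕ}

/-- The padded target `⟨m⟩ ⊠ ⟨2,2,2⟩^{⊠N} ⊕ ⟨k⟩ ⊠ P^{⊠N}` is concise on the input leg.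
[cite: BurgisserClausenShokrollahi1997, §14.4] -/
theorem padded_weight_eq_zero {w : J N m ⊕ J N k → ℂ}
    (h : slice (directSumTensor (tgt N m) (src N k)) w = 0) : w = 0 := by
  rw [slice_directSum] at h
  have h1 : slice (tgt N m) (fun b => w (Sum.inl b)) = 0 := by
    ext a c; simpa using congrFun (congrFun h (Sum.inl a)) (Sum.inl c)
  have h2 : slice (src N k) (fun b => w (Sum.inr b)) = 0 := by
    ext a c; simpa using congrFun (congrFun h (Sum.inr a)) (Sum.inr c)
  funext x
  rcases x with b | b
  · exact congrFun (tgt_weight_eq_zero N m h1) b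
  · exact congrFun (src_weight_eq_zero N k h2) b

/-- The padded target is concise on the output leg.
[cite: BurgisserClausenShokrollahi1997, §14.4] -/
theorem padded_vec_eq_zero {ζ : J N m ⊕ J N k → ℂ}
    (h : ∀ w, (slice (directSumTensor (tgt N m) (src N k)) w).mulVec ζ = 0) : ζ = 0 := by
  have h1 : ζ ∘ Sum.inl = 0 := by
    refine tgt_vec_eq_zero N m fun w₁ => ?_
    have e := h (Sum.elim w₁ 0)
    rw [slice_directSum, Matrix.fromBlocks_mulVec] at e
    funext a
    have ea := congrFun e (Sum.inl a)
    simp only [Sum.elim_inl, Sum.elim_inr, Pi.zero_apply, Matrix.zero_mulVec, add_zero] at ea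
    exact ea
  have h2 : ζ ∘ Sum.inr = 0 := by
    refine src_vec_eq_zero N k fun w₂ => ?_
    have e := h (Sum.elim 0 w₂)
    rw [slice_directSum, Matrix.fromBlocks_mulVec] at e
    funext a
    have ea := congrFun e (Sum.inr a)
    simp only [Sum.elim_inl, Sum.elim_inr, Pi.zero_apply, Matrix.zero_mulVec, zero_add] at ea
    exact ea
  funext x
  rcases x with c | c
  · exact congrFun h1 c
  · exact congrFun h2 c

/-- The two formats agree: `m·4^N + k·4^N = (m+k)·4^N`. [folklore] -/
theorem card_padded (N m k : ℕ) :
    Fintype.card (J N m ⊕ J N k) = Fintype.card (J N (m + k)) := by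
  simp only [J, Fintype.card_sum, Fintype.card_prod, Fintype.card_fin, Fintype.card_fun]
  ring

end Main

end Summit.MatrixMultiplication.MatrixMultiplication.Theorems.OutsiderSandwichSliceConcise
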